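import Summits.CriticalPhenomena.PercolationContinuityZ3.Theorems.PercNearOneGluingNoHeavyLowerTailSahiCTCLadderKindsGeneral
import HarnessLib

/-!
# `NoHeavyLowerTail` (crux stmt-CriticalPhenomena-4575), P3 lane: double counting of charged pairs over the cubes of a type

Support file (seat `prim-l12-p3`, gen 26; `--supports stmt-CriticalPhenomena-4575`).  README blueprint step 2 in general form:
* `card_powersetCard_filter_sdiff_subset`: `#{A ∈ binom(D,i) : D ∖ A ⊆ B} = C(#B, i + #B − #D)` (`B ⊆ D`, `#D ≤ i + #B`);
* `powersetCard_filter_disjoint`: `{Y ∈ binom(T,s) : Disjoint Y' Y} = binom(T ∖ Y', s)`;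
* `card_inter_fst_of_mem_kindsIn`: inside the cube `(A, Y)` every charged pair of kind `j` meets `A` in exactly `#A + j − #D` points;
* `sum_card_kindsIn`: `Σ_{(A,Y) : #A = i, #Y = t−i} #kindsIn_j(A,Y) = #K_j · C(j, i + j − #D) · C(#T − (t − j), t − i)` where `K_j` = all
  charged pairs of kind `j`.
Nothing is asserted about the crux.
-/

namespace Summit.CriticalPhenomena.PercolationContinuityZ3.Theorems.SahiCTCForms

open Finset MvPolynomial SahiCTCGenFun SahiCTCWeightedLYM

variable {α : Type*} [DecidableEq α] [Fintype α]

section CountsGeneral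
variable {𝒳 𝒵 : Finset (Finset α)}

omit [Fintype α] in
/-- `#{A ∈ binom(D,i) : D ∖ A ⊆ B} = C(#B, i + #B − #D)` for `B ⊆ D`, `#D ≤ i + #B`. [folklore] -/
theorem card_powersetCard_filter_sdiff_subset {D B : Finset α} (hB : B ⊆ D) {i : ℕ} (hi : #D ≤ i + #B) :
    #((D.powersetCard i).filter fun A => D \ A ⊆ B) = (#B).choose (i + #B - #D) := by
  have hBD : #B ≤ #D := card_le_card hB
  rw [← card_powersetCard (i + #B - #D) B]
  symm
  refine card_nbij (fun C => D \ B ∪ C) (fun C hC => ?_) (fun C hC C' hC' h => ?_) (fun A hA => ?_)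
  · obtain ⟨hCB, hCc⟩ := mem_powersetCard.1 hC
    refine mem_filter.2 ⟨mem_powersetCard.2 ⟨union_subset sdiff_subset (hCB.trans hB), ?_⟩, fun x hx => ?_⟩
    · rw [card_union_of_disjoint (disjoint_sdiff_self_left.mono_right hCB), card_sdiff_of_subset hB, hCc]; omega
    · rw [mem_sdiff, mem_union, not_or, mem_sdiff] at hx
      by_contra hxB; exact hx.2.1 ⟨hx.1, hxB⟩
  · have hCB := (mem_powersetCard.1 (Finset.mem_coe.1 hC)).1
    have hCB' := (mem_powersetCard.1 (Finset.mem_coe.1 hC')).1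
    have e := congrArg (fun s => s ∩ B) h
    simp only [union_inter_distrib_right, sdiff_inter_self, empty_union, inter_eq_left.2 hCB, inter_eq_left.2 hCB'] at e
    exact e
  · obtain ⟨hA, hsub⟩ := mem_filter.1 (Finset.mem_coe.1 hA)
    obtain ⟨hAD, hAc⟩ := mem_powersetCard.1 hA
    refine ⟨A ∩ B, Finset.mem_coe.2 (mem_powersetCard.2 ⟨inter_subset_right, ?_⟩), ?_⟩
    · have h1 : #(A ∩ B) + #(A \ B) = i := by rw [card_inter_add_card_sdiff, hAc]
      have h2 : A \ B = D \ B := by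
        ext x; simp only [mem_sdiff]
        constructor
        · rintro ⟨hx, hxB⟩; exact ⟨hAD hx, hxB⟩
        · rintro ⟨hx, hxB⟩; exact ⟨by_contra fun hxA => hxB (hsub (mem_sdiff.2 ⟨hx, hxA⟩)), hxB⟩
      rw [h2, card_sdiff_of_subset hB] at h1; omega
    · show D \ B ∪ A ∩ B = A
      ext x; simp only [mem_union, mem_sdiff, mem_inter]
      constructor
      · rintro (⟨hx, hxB⟩ | ⟨hx, _⟩)
        · by_contra hxA; exact hxB (hsub (mem_sdiff.2 ⟨hx, hxA⟩))
        · exact hx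
      · intro hx; by_cases hxB : x ∈ B
        · exact Or.inr ⟨hx, hxB⟩
        · exact Or.inl ⟨hAD hx, hxB⟩

omit [Fintype α] in
/-- `{Y ∈ binom(T,s) : Disjoint Y' Y} = binom(T ∖ Y', s)`. [folklore] -/
theorem powersetCard_filter_disjoint (T Y' : Finset α) (s : ℕ) :
    ((T.powersetCard s).filter fun Y => Disjoint Y' Y) = (T \ Y').powersetCard s := by
  ext Y
  rw [mem_filter, mem_powersetCard, mem_powersetCard, subset_sdiff, disjoint_comm]
  tauto

omit [Fintype α] in
/-- Inside the cube `(A, Y)` a charged pair `(A', Y')` of kind `j` meets `A` in `#A + j − #D` points and misses `#D − j` of them. [this work] -/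
theorem card_inter_fst_of_mem_kindsIn {m : α →₀ ℕ} {t j : ℕ} {A Y : Finset α} (hA : A ⊆ dbl m) {q : Finset α × Finset α}
    (hq : q ∈ kindsIn 𝒳 𝒵 m t j A Y) : #(A ∩ q.1) + #(dbl m) = #A + j ∧ #(A \ q.1) + j = #(dbl m) := by
  obtain ⟨⟨hA', hj'⟩, -, -, hsub, -⟩ := mem_kindsIn.1 hq
  have h1 : #(A ∩ q.1) + #(A \ q.1) = #A := card_inter_add_card_sdiff _ _
  have h2 : A \ q.1 = dbl m \ q.1 := by
    ext x; simp only [mem_sdiff]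
    constructor
    · rintro ⟨hx, hxq⟩; exact ⟨hA hx, hxq⟩
    · rintro ⟨hx, hxq⟩; exact ⟨by_contra fun hxA => hxq (hsub (mem_sdiff.2 ⟨hx, hxA⟩)), hxq⟩
  have h4 : j ≤ #(dbl m) := hj' ▸ card_le_card hA'
  have h5 : #(A \ q.1) = #(dbl m) - j := by rw [h2, card_sdiff_of_subset hA', hj']
  omega

/-- All charged pairs of kind `j` (no cube condition). [this work] -/
def kindsAll (𝒳 𝒵 : Finset (Finset α)) (m : α →₀ ℕ) (t j : ℕ) : Finset (Finset α × Finset α) :=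
  (((dbl m).powersetCard j) ×ˢ ((lev m 1).powersetCard (t - j))).filter fun q => q.1 ∪ q.2 ∈ 𝒳 ∧ q.1 ∪ q.2 ∈ 𝒵

omit [Fintype α] in
/-- `kindsIn … A Y` is `kindsAll` cut down by the cube condition. [this work] -/
theorem kindsIn_eq_filter (m : α →₀ ℕ) (t j : ℕ) (A Y : Finset α) :
    kindsIn 𝒳 𝒵 m t j A Y = (kindsAll 𝒳 𝒵 m t j).filter fun q => dbl m \ A ⊆ q.1 ∧ Disjoint q.2 Y := by
  unfold kindsIn kindsAll; rw [filter_filter]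

omit [Fintype α] in
/-- **Double counting over the cubes of type `i`**:
`Σ_{A ∈ binom(D,i)} Σ_{Y ∈ binom(T,t−i)} #kindsIn_j(A,Y) = #kindsAll_j · C(j, i + j − #D) · C(#T − (t − j), t − i)`
(for `#D ≤ i + j`). [this work] -/
theorem sum_card_kindsIn {m : α →₀ ℕ} {t i j : ℕ} (hij : #(dbl m) ≤ i + j) :
    ∑ A ∈ (dbl m).powersetCard i, ∑ Y ∈ (lev m 1).powersetCard (t - i), #(kindsIn 𝒳 𝒵 m t j A Y)
      = #(kindsAll 𝒳 𝒵 m t j) * (j.choose (i + j - #(dbl m)) * (#(lev m 1) - (t - j)).choose (t - i)) := by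
  have key : ∀ A ∈ (dbl m).powersetCard i, ∑ Y ∈ (lev m 1).powersetCard (t - i), #(kindsIn 𝒳 𝒵 m t j A Y)
      = ∑ q ∈ kindsAll 𝒳 𝒵 m t j, (if dbl m \ A ⊆ q.1 then (#(lev m 1) - (t - j)).choose (t - i) else 0) := by
    intro A hA
    have h := sum_card_bipartiteAbove_eq_sum_card_bipartiteBelow (s := (lev m 1).powersetCard (t - i))
      (t := kindsAll 𝒳 𝒵 m t j) (r := fun Y q => dbl m \ A ⊆ q.1 ∧ Disjoint q.2 Y)
    simp only [bipartiteAbove, bipartiteBelow] at h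
    simp_rw [kindsIn_eq_filter]
    rw [h]
    refine sum_congr rfl fun q hq => ?_
    obtain ⟨hq1, _⟩ := mem_filter.1 hq
    obtain ⟨_, hY'⟩ := mem_product.1 hq1
    obtain ⟨hY'T, hY'c⟩ := mem_powersetCard.1 hY'
    by_cases hsub : dbl m \ A ⊆ q.1
    · rw [if_pos hsub]
      have : ((lev m 1).powersetCard (t - i)).filter (fun Y => dbl m \ A ⊆ q.1 ∧ Disjoint q.2 Y)
          = ((lev m 1).powersetCard (t - i)).filter (fun Y => Disjoint q.2 Y) := filter_congr fun Y _ => by simp [hsub]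
      rw [this, powersetCard_filter_disjoint, card_powersetCard, card_sdiff_of_subset hY'T, hY'c]
    · rw [if_neg hsub]
      simp [hsub]
  rw [sum_congr rfl key, sum_comm]
  simp_rw [← sum_filter, sum_const, smul_eq_mul]
  have hfib : ∀ q ∈ kindsAll 𝒳 𝒵 m t j, #(((dbl m).powersetCard i).filter fun A => dbl m \ A ⊆ q.1) = j.choose (i + j - #(dbl m)) := by
    intro q hq
    obtain ⟨hq1, _⟩ := mem_filter.1 hq
    obtain ⟨hA', _⟩ := mem_product.1 hq1
    obtain ⟨hA'D, hA'c⟩ := mem_powersetCard.1 hA'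
    rw [card_powersetCard_filter_sdiff_subset hA'D (by omega), hA'c]
  rw [sum_congr rfl fun q hq => by rw [hfib q hq], sum_const, smul_eq_mul]

end CountsGeneral

end Summit.CriticalPhenomena.PercolationContinuityZ3.Theorems.SahiCTCForms
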